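import Mathlib
import Summits.ValiantsHypothesis.ValiantsHypothesis.Theorems.NewtonTauWeak.Negative.Zonogon
import Summits.ValiantsHypothesis.ValiantsHypothesis.Theorems.NewtonUnitEquationsNewtonTauWeakAutomatonGenDefs

/-!
# `NewtonTauWeak` (stmt-ValiantsHypothesis-5904), line `binomial-normal-form`: objects of the MIXED-RADIX CARRY AUTOMATON
# (lead c5, THEOREM C: every synchronised-automatic frame, K-uniform)

Route-posited objects (D-0016 `…Defs` file) generalising `…AutomatonGenDefs.lean` (THEOREM B, binary digit frames, p128432) from
the radix `(2, 2)` to an arbitrary radix pair `(bx, by)`: a product `Π_{i<n} G_i(x^{bx^i}, y^{by^i})` (`radProd`, via the algebra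
map `x ↦ x^{bx^i}, y ↦ y^{by^i}`, `radExpand`) with level polynomials of degree `≤ C` in each variable has coefficient at `(p, q)`
equal to an entry of the ordered product of the CARRY TRANSFER MATRICES `radT bx by C G_i p_i q_i` on the states `κ ∈ {0..C}²`,
reading the base-`bx` digits `p_i = p / bx^i % bx` of `p` and the base-`by` digits of `q`: entry `κ → κ'` = the coefficient of
`G_i` at `(bx κ'₁ + p_i - κ₁, by κ'₂ + q_i - κ₂)`.  Mixed radix is what makes "parabola digit" frames `{(2^i, 4^i)}` (with axis
digits) automatic — radix `(2, 4)` — and base-`t` digit grids with several factors per level (KPTT Example 3 with multiplicity)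
automatic — radix `(t, t)`; see `Cruxes/NewtonTauWeak/Lines/binomial-normal-form-c5.md` §1(iii).  Everything here is a
definition; the states/index types `GSt`, `GIdx`, `gidxEquiv`, `shiftLev` and the contraction `genContract` of the binary file
are reused verbatim (they do not depend on the radix). [folklore: carry automaton / transfer matrices in mixed radix]
-/

-- the namespace mandated for this Theorems file repeats the component `ValiantsHypothesis`
set_option linter.dupNamespace false

noncomputable section

open scoped BigOperators
open MvPolynomial

namespace Summit.ValiantsHypothesis.ValiantsHypothesis.Theorems.NewtonTauWeakAutomaton

/-! ## Digits and transfer matrices in radix `(bx, by)` -/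

/-- The `i`-th digit of `p` in base `b`: `p / b^i % b`. [folklore] -/
def digit (b i p : ℕ) : ℕ := p / b ^ i % b

/-- The carry transfer matrix of a level polynomial `G` (degree `≤ C` in each variable) reading the digit pair `(p, q)` in radix
`(bx, by)`: entry `κ → κ'` is the coefficient of `G` at the forced level contribution `(bx κ'₁ + p - κ₁, by κ'₂ + q - κ₂)` (zero if
negative). The binary `genT` is the case `bx = by = 2`. [folklore] -/
def radT (bx by' C : ℕ) (G : MvPolynomial (Fin 2) ℂ) (p q : ℕ) : Matrix (GSt C) (GSt C) ℂ := fun κ κ' =>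
  if (κ.1 : ℕ) ≤ bx * κ'.1 + p ∧ (κ.2 : ℕ) ≤ by' * κ'.2 + q then
    coeff (Finsupp.single 0 (bx * (κ'.1 : ℕ) + p - κ.1) + Finsupp.single 1 (by' * (κ'.2 : ℕ) + q - κ.2)) G
  else 0

/-- The ordered product of the transfer matrices of the levels `lo, …, lo+len-1`, reading the base-`bx` digits of `P.1` and the
base-`by` digits of `P.2` at those levels. [folklore] -/
def radN (bx by' C : ℕ) (G : ℕ → MvPolynomial (Fin 2) ℂ) (lo len : ℕ) (P : ℕ × ℕ) : Matrix (GSt C) (GSt C) ℂ :=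
  ((List.range' lo len).map fun i => radT bx by' C (G i) (digit bx i P.1) (digit by' i P.2)).prod

/-! ## The vector configuration of `k` products -/

/-- The configuration vector at position `P` of `k` products with level polynomials `G : Fin k → ℕ → …`, over the levels
`[lo, lo+len)`, in radix `(bx, by)`: all entries of all `k` transfer-matrix products. [folklore] -/
def radVec (bx by' k C : ℕ) (G : Fin k → ℕ → MvPolynomial (Fin 2) ℂ) (lo len : ℕ) (P : ℕ × ℕ) : GIdx k C → ℂ :=
  fun i => radN bx by' C (G i.1) lo len P i.2.1 i.2.2

/-- The same vector, flattened (the shape used by Theorem Q's `QuasiPoly.cshadow`). [folklore] -/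
def radVecFin (bx by' k C : ℕ) (G : Fin k → ℕ → MvPolynomial (Fin 2) ℂ) (lo len : ℕ) (P : ℕ × ℕ) :
    Fin (k * ((C + 1) * (C + 1) * ((C + 1) * (C + 1)))) → ℂ :=
  fun j => radVec bx by' k C G lo len P ((gidxEquiv k C).symm j)

/-! ## The polynomials -/

/-- The radix substitution `x ↦ x^a, y ↦ y^b` (an algebra endomorphism of `ℂ[x, y]`). [folklore] -/
def radExpand (a b : ℕ) : MvPolynomial (Fin 2) ℂ →ₐ[ℂ] MvPolynomial (Fin 2) ℂ :=
  MvPolynomial.aeval fun j : Fin 2 => (X j : MvPolynomial (Fin 2) ℂ) ^ (if j = 0 then a else b)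

/-- A mixed-radix digit-scaled product with `n` levels: `Π_{i<n} G_i(x^{bx^i}, y^{by^i})`. [folklore] -/
def radProd (bx by' : ℕ) (G : ℕ → MvPolynomial (Fin 2) ℂ) (n : ℕ) : MvPolynomial (Fin 2) ℂ :=
  ∏ i ∈ Finset.range n, radExpand (bx ^ i) (by' ^ i) (G i)

/-- A sum of `k` scalar multiples of mixed-radix digit-scaled products on a common `n`-level hierarchy. [folklore] -/
def radSum (bx by' k n : ℕ) (c : Fin k → ℂ) (G : Fin k → ℕ → MvPolynomial (Fin 2) ℂ) : MvPolynomial (Fin 2) ℂ :=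
  ∑ l, C (c l) * radProd bx by' (G l) n

/-- The mixed-radix box of positions with `n` levels: `[0, bx^n) × [0, by^n)`. [folklore] -/
def radBox (bx by' n : ℕ) : Finset (ℕ × ℕ) := Finset.range (bx ^ n) ×ˢ Finset.range (by' ^ n)

/-- The mixed-radix box has `bx^n · by^n` points (anchor theorem of this Defs file). -/
theorem card_radBox (bx by' n : ℕ) : (radBox bx by' n).card = bx ^ n * by' ^ n := by
  simp [radBox, Finset.card_product]

end Summit.ValiantsHypothesis.ValiantsHypothesis.Theorems.NewtonTauWeakAutomaton

end
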